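import Literature.Computability.Complexity.TimeBounds
import Literature.Computability.Complexity.BoolEncodings
import Literature.Computability.Complexity.Classes
import Literature.Computability.Complexity.Nondeterministic
import Literature.Computability.Complexity.Reductions
import Literature.Computability.Complexity.ProbabilisticClasses
import HarnessLib

-- provenance: harness21/H21/H21/Prelude/CplxCore/Oracle.lean @ 6f9f43a (interim HEAD d8f2665); M5 mechanical rewrite
/-!
# Complexity core: oracle computation and polynomial-time Turing reductions

Trunk `CplxCore`, concept C9 (`Oracle`; realises the notions `oracle_tm` and the Cook/Turing
half of `polytime_reduction`). Following outline D3, there is **no surgery on Mathlib's TM2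
model**: an oracle computation is an *interactive transcript*. An oracle is a total string
function `O : Oracle := List Bool → List Bool`; an oracle algorithm `M : OracleAlg β` is a step
function `step : List Bool → List (List Bool) → List Bool ⊕ β` mapping (input, oracle answers
received so far) to either the next query (`Sum.inl q`) or the final output (`Sum.inr b`). It is
run for a bounded number of rounds (`OracleAlg.run`, fuel = round budget), and it is
*polynomial-time* (`OracleAlg.IsPolyTime`) when the step function is `PolyTimeComputable` on the
`boolPair`-encoded pair (input, list of answers). Relativised classes:

* `PRel O` (`P^O`), `FPRel O` (`FP^O`), `NPRel O := polyExists (PRel O)`, `coNPRel O`,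
  `BPPRel O := bp (PRel O)`;
* `PolyTimeTuringReducible L₁ L₂ := L₁ ∈ PRel (Oracle.ofLanguage L₂)` (Cook reducibility),
  notation `L₁ ≤ᵀₚ L₂` scoped in `namespace Literature.CplxCore.Notation`;
* `PRelClass C := ⋃ L ∈ C, PRel (Oracle.ofLanguage L)` (so `P^NP = PRelClass NP`),
  `NPRelClass`, `BPPRelClass`.

API (proofs of known theorems may be `sorry`): `PRel_empty : PRel Oracle.empty = P`,
`P_subset_PRel`, `self_mem_PRel_ofLanguage`, `PolyTimeKarpReducible.turing`,
`polyTimeTuringReducible_refl`, `polyTimeTuringReducible_trans`, `PRel_subset_NPRel`,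
`OracleAlg.run_mono`, `OracleAlg.isPolyTime_ofFun`.

Mathlib has only the *unbounded* (computability-theoretic) analogues: `RecursiveIn O f`
(`Mathlib/Computability/RecursiveIn.lean`) and `TuringReducible f g`, notation `f ≤ᵀ g`
(`Mathlib/Computability/TuringDegree.lean`), both on partial functions `ℕ →. ℕ` and without any
resource bound; there is no oracle Turing machine, no relativised class and no polynomial-time
Turing reducibility in Mathlib (searched `Oracle`, `TuringReducible`, `RecursiveIn`, `Relativ`).
We reuse `Computability.Encoding`, `encodeBool`, `encodeNat`, `encodingBoolBool`,
`encodingList`, `Polynomial.eval`, `Set.boolIndicator`, and the H21 notions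
`PolyTimeComputable`, `boolPair`, `Encoding.listBool`, `Encoding.sumBool`, `P`, `FP`,
`polyExists`, `co`, `bp`, `PolyTimeKarpReducible`.

## Design notes

* **Resource bounds, adequacy and caveat.** `PRel O` (and `FPRel O`) require, for one
  polynomial `q`, that on input `x` (i) the run halts within `q |x|` rounds, (ii) every query
  asked has length `≤ q |x|`, and (iii) the step function is polynomial-time in the transcript
  so far (`IsPolyTime`). Clause (ii) is essential: without it the transcript (hence the allowed
  step time) is bounded only by an *iterated* polynomial when answers may be longer than
  queries (e.g. `O = Oracle.ofFun (fun q => 2 ^ (|q| ^ 2))`, an `FP` function, would give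
  `EXP ⊆ P^O`). With (i)–(iii), `PRel O` coincides with the textbook `P^O` (unit-cost oracle
  tape) for every *polynomially bounded* oracle, i.e. one with `|O y| ≤ r |y|` for a polynomial
  `r` — in particular for `Oracle.ofLanguage A` (one-bit answers) and `Oracle.ofFun f` with
  `f y < 2 ^ poly |y|` (e.g. `f ∈ #P`): all answers have length `≤ r (q |x|)`, the transcript has
  polynomial length, so each of the `≤ q |x|` step evaluations runs in time polynomial in `|x|`;
  conversely a `p(n)`-time oracle TM asks at most `p(n)` queries, each of length `≤ p(n)`, and is
  simulated by replaying its run from the transcript at every step. For oracles with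
  super-polynomially long answers the step function is still allowed time polynomial in the
  *answers* it has received, which is more generous than the textbook model; no H21 statement
  uses such oracles. The model is also not adequate below polynomial slack (fine-grained oracle
  statements must not use it; outline R2).
* Halting rule (outline D1): `IsPolyTime` bounds the step time by a polynomial in the length of
  the full machine input `boolPair x (encode answers)`, which dominates `|x|`, as required.
* Fuel semantics: `run M O k x` evaluates `step` at most `k` times; it returns `none` if no
  output was produced within `k` rounds (`run_mono`: more fuel never changes an output).
  `queries` records the queries asked (the transcript); `PRel`/`FPRel` bound their lengths.
* `encodingList Bool` is Mathlib's identity encoding of strings (its `decode` is `some`), so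
  `(encodingList Bool).listBool` encodes a list of strings via iterated `boolPair`, and
  `(encodingList Bool).sumBool eb` encodes `List Bool ⊕ β` with a tag bit (file
  `BoolEncodings.lean`). No bare `encodeNat` suffix occurs.
* Definitions mentioning `Set.boolIndicator` or `P` are `noncomputable` (outline D7).
* The notation `≤ᵀₚ` is scoped in `Literature.CplxCore.Notation` (outline D7), like `≤ₚ`; Mathlib's
  global `≤ᵀ` (Turing degrees) is a different token.
* Transitivity of `≤ᵀₚ` and `PRel_empty` need composition/simulation of polynomial-time
  machines (`PolyTimeComputable.comp`, a Mathlib `proof_wanted`), hence are `sorry`d known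
  theorems; no `IsTrans`/`IsPreorder` instance is registered.

## References

* S. A. Cook, *The complexity of theorem-proving procedures*, STOC 1971, §1 (query machines,
  P-reducibility = polynomial-time Turing reducibility).
* T. Baker, J. Gill, R. Solovay, *Relativizations of the P =? NP question*, SIAM J. Comput. 4
  (1975), §1 (oracle machines, `P^X`, `NP^X`).
* S. Arora, B. Barak, *Computational Complexity: A Modern Approach*, CUP 2009, §3.4, Def. 3.4
  (oracle Turing machines, `P^O`, `NP^O`), Def. 5.4 area (`P^{NP}`, `Σ₂ = NP^{NP}`), §17.2
  (`P^{#P}`, `FP^{#P}`).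
* R. E. Ladner, N. A. Lynch, A. L. Selman, *A comparison of polynomial time reducibilities*,
  Theoret. Comput. Sci. 1 (1975), §2 (`≤ᵀₚ` vs `≤ₘₚ`; Karp implies Cook; transitivity).
* Mathlib `RecursiveIn`, `TuringReducible` (unbounded analogues, for comparison only).
-/

namespace Literature.Computability.Complexity

open _root_.Computability

variable {β : Type}

/-! ### Oracles -/

/-- An oracle: a total function on bit strings `O : {0,1}* → {0,1}*`, answering each query
string with an answer string. Language oracles are the special case of one-bit answers
(`Oracle.ofLanguage`); function oracles (`#P`-oracles) answer in binary (`Oracle.ofFun`).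
[Baker–Gill–Solovay 1975, §1; Arora–Barak 2009, §3.4 and §17.2] [cite: BakerGillSolovay1975, §1] -/
abbrev Oracle : Type := List Bool → List Bool

namespace Oracle

/-- The oracle of a language `A ⊆ {0,1}*`: the query `q` is answered by the bit `[q ∈ A]`
(encoded by `Computability.encodeBool`, a one-symbol string). Noncomputable
(`Set.boolIndicator`). [Baker–Gill–Solovay 1975, §1; Arora–Barak 2009, Def. 3.4] [cite: BakerGillSolovay1975, §1] -/
noncomputable def ofLanguage (A : Language Bool) : Oracle :=
  fun q => encodeBool (A.boolIndicator q)

/-- The oracle of a function `f : {0,1}* → ℕ` (e.g. `f ∈ #P`): the query `q` is answered by the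
binary encoding `encodeNat (f q)` (the answer is a whole string, so `encodeNat 0 = []` is
harmless here). [Arora–Barak 2009, §17.2 (`P^{#P}`, `FP^{#P}`)] [cite: AroraBarak2009, §17.2 ( P^{#P}    FP^{#P}] -/
def ofFun (f : List Bool → ℕ) : Oracle :=
  encodeNat ∘ f

/-- The empty oracle `∅` (every query answered "no"), so that `P^∅ = P` (`PRel_empty`).
[Baker–Gill–Solovay 1975, §1] [cite: BakerGillSolovay1975, §1] -/
noncomputable def empty : Oracle :=
  ofLanguage (0 : Language Bool)

/-- The oracle of a language answers with the indicator bit (definitional unfolding). [folklore] -/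
@[simp] theorem ofLanguage_apply (A : Language Bool) (q : List Bool) :
    ofLanguage A q = encodeBool (A.boolIndicator q) :=
  rfl

/-- The oracle of a function answers with the binary encoding of the value (definitional
unfolding). [folklore] -/
@[simp] theorem ofFun_apply (f : List Bool → ℕ) (q : List Bool) :
    ofFun f q = encodeNat (f q) :=
  rfl

/-- The empty oracle answers every query with `encodeBool false`.
[Baker–Gill–Solovay 1975, §1] [cite: BakerGillSolovay1975, §1] -/
@[simp] theorem empty_apply (q : List Bool) : empty q = encodeBool false := by
  simp [empty, ofLanguage, Language.zero_def, Set.boolIndicator]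

end Oracle

/-! ### Oracle algorithms as interactive transcripts -/

/-- An oracle algorithm with outputs in `β`, presented by its *step function*: given the input
`x` and the list of oracle answers received so far (in order), `step x answers` is either the
next query `Sum.inl q` or the final output `Sum.inr b`. Running it against an oracle produces
the interactive transcript of an oracle Turing machine computation; polynomial time is imposed
separately (`OracleAlg.IsPolyTime` plus a polynomial round budget in `PRel`).
[Arora–Barak 2009, §3.4, Def. 3.4 (oracle TMs); H21 outline `CplxCore` D3] [cite: AroraBarak2009, §3.4  Def. 3.4 (oracle TMs] -/
structure OracleAlg (β : Type) where
  /-- The step function: input and answers so far ↦ next query or output. -/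
  step : List Bool → List (List Bool) → List Bool ⊕ β

namespace OracleAlg

/-- Fuel-indexed runner: `M.runAux O x k answers` continues the interaction of `M` with the
oracle `O` on input `x` from the partial transcript `answers`, evaluating `step` at most `k`
more times; a query `q` is answered by appending `O q` to the transcript, an output `b` ends the
run with `some b`, and exhausting the fuel yields `none`. [Arora–Barak 2009, §3.4] [cite: AroraBarak2009, §3.4] -/
def runAux (M : OracleAlg β) (O : Oracle) (x : List Bool) : ℕ → List (List Bool) → Option β
  | 0, _ => none
  | k + 1, answers =>
    match M.step x answers with
    | Sum.inl q => runAux M O x k (answers ++ [O q])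
    | Sum.inr b => some b

/-- `M.run O k x`: the output of the oracle algorithm `M` with oracle `O` on input `x` within a
budget of `k` rounds (step evaluations), or `none` if no output is produced within the budget.
[Arora–Barak 2009, §3.4, Def. 3.4] [cite: AroraBarak2009, §3.4  Def. 3.4] -/
def run (M : OracleAlg β) (O : Oracle) (k : ℕ) (x : List Bool) : Option β :=
  M.runAux O x k []

/-- Fuel-indexed transcript: the list of queries asked by `M` (with oracle `O`, input `x`) when
continued from the partial answer list `answers` for at most `k` rounds.
[Arora–Barak 2009, §3.4] [cite: AroraBarak2009, §3.4] -/
def queriesAux (M : OracleAlg β) (O : Oracle) (x : List Bool) :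
    ℕ → List (List Bool) → List (List Bool)
  | 0, _ => []
  | k + 1, answers =>
    match M.step x answers with
    | Sum.inl q => q :: queriesAux M O x k (answers ++ [O q])
    | Sum.inr _ => []

/-- `M.queries O k x`: the transcript of queries asked by `M` with oracle `O` on input `x`
within `k` rounds, in order. [Arora–Barak 2009, §3.4 (oracle queries)] [cite: AroraBarak2009, §3.4 (oracle queries] -/
def queries (M : OracleAlg β) (O : Oracle) (k : ℕ) (x : List Bool) : List (List Bool) :=
  M.queriesAux O x k []

/-- With no fuel the run produces no output. [folklore] -/
@[simp] theorem runAux_zero (M : OracleAlg β) (O : Oracle) (x : List Bool)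
    (answers : List (List Bool)) : M.runAux O x 0 answers = none :=
  rfl

/-- One round of the runner: query ↦ recurse with the answer appended; output ↦ halt. [folklore] -/
theorem runAux_succ (M : OracleAlg β) (O : Oracle) (x : List Bool) (k : ℕ)
    (answers : List (List Bool)) :
    M.runAux O x (k + 1) answers =
      match M.step x answers with
      | Sum.inl q => M.runAux O x k (answers ++ [O q])
      | Sum.inr b => some b :=
  rfl

/-- More fuel never changes a produced output (the runner is monotone in the fuel).
[Arora–Barak 2009, §3.4] [cite: AroraBarak2009, §3.4] -/
theorem runAux_mono (M : OracleAlg β) (O : Oracle) (x : List Bool) {k k' : ℕ} (hk : k ≤ k')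
    {answers : List (List Bool)} {b : β} (h : M.runAux O x k answers = some b) :
    M.runAux O x k' answers = some b := by
  induction k generalizing k' answers with
  | zero => simp at h
  | succ k ih =>
    obtain ⟨k', rfl⟩ := Nat.exists_eq_add_of_le hk
    rw [show k + 1 + k' = (k + k') + 1 by omega, runAux_succ]
    rw [runAux_succ] at h
    cases hs : M.step x answers with
    | inl q =>
      rw [hs] at h
      exact ih (Nat.le_add_right k k') h
    | inr b' => simpa [hs] using h

/-- More rounds never change a produced output. [Arora–Barak 2009, §3.4] [cite: AroraBarak2009, §3.4] -/
theorem run_mono (M : OracleAlg β) (O : Oracle) (x : List Bool) {k k' : ℕ} (hk : k ≤ k')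
    {b : β} (h : M.run O k x = some b) : M.run O k' x = some b :=
  M.runAux_mono O x hk h

/-- With no fuel no query is asked (auxiliary form). [folklore] -/
@[simp] theorem queriesAux_zero (M : OracleAlg β) (O : Oracle) (x : List Bool)
    (answers : List (List Bool)) : M.queriesAux O x 0 answers = [] :=
  rfl

/-- With no fuel no query is asked. [folklore] -/
@[simp] theorem queries_zero (M : OracleAlg β) (O : Oracle) (x : List Bool) :
    M.queries O 0 x = [] :=
  rfl

/-- The number of queries asked within `k` rounds is at most `k`. [Arora–Barak 2009, §3.4] [cite: AroraBarak2009, §3.4] -/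
theorem length_queriesAux_le (M : OracleAlg β) (O : Oracle) (x : List Bool) (k : ℕ)
    (answers : List (List Bool)) : (M.queriesAux O x k answers).length ≤ k := by
  induction k generalizing answers with
  | zero => simp [queriesAux]
  | succ k ih =>
    unfold queriesAux
    cases M.step x answers with
    | inl q => simpa using ih (answers ++ [O q])
    | inr b => simp

/-- The transcript within `k` rounds has at most `k` queries. [Arora–Barak 2009, §3.4] [cite: AroraBarak2009, §3.4] -/
theorem length_queries_le (M : OracleAlg β) (O : Oracle) (k : ℕ) (x : List Bool) :
    (M.queries O k x).length ≤ k :=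
  M.length_queriesAux_le O x k []

/-- An oracle algorithm that never queries: output `f x` immediately. Used to embed `P` into
`P^O`. [Baker–Gill–Solovay 1975, §1 (`P ⊆ P^X`)] [cite: BakerGillSolovay1975, §1 ( P ⊆ P^X] -/
def ofFun (f : List Bool → β) : OracleAlg β where
  step x _ := Sum.inr (f x)

/-- A query-free algorithm outputs `f x` within any positive round budget. [folklore] -/
@[simp] theorem run_ofFun_succ (f : List Bool → β) (O : Oracle) (k : ℕ) (x : List Bool) :
    (ofFun f).run O (k + 1) x = some (f x) :=
  rfl

/-- A query-free algorithm asks no queries. [folklore] -/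
@[simp] theorem queries_ofFun (f : List Bool → β) (O : Oracle) (k : ℕ) (x : List Bool) :
    (ofFun f).queries O k x = [] := by
  cases k <;> rfl

/-- `M.IsPolyTime eb`: the step function of `M` is polynomial-time computable as a function of
the pair (input, answers so far), the pair being presented as
`boolPair x ((encodingList Bool).listBool.encode answers)` and the result `List Bool ⊕ β` being
encoded with a tag bit via `(encodingList Bool).sumBool eb`. Together with a polynomial round
budget this is polynomial-time oracle computation (see the module docstring for the adequacy
caveat). [Arora–Barak 2009, §3.4; Cook 1971, §1; H21 outline `CplxCore` D3] [cite: AroraBarak2009, §3.4] -/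
def IsPolyTime (M : OracleAlg β) (eb : Encoding β Bool) : Prop :=
  PolyTimeComputable
    (fun p : List Bool × List (List Bool) => boolPair p.1 ((encodingList Bool).listBool.encode p.2))
    ((encodingList Bool).sumBool eb).encode (Function.uncurry M.step)

/-- A query-free algorithm `ofFun f` is polynomial-time as soon as `f` is polynomial-time on
the first component of the encoded pair (project with `polyTimeComputable_fst`, then compose;
needs `PolyTimeComputable.comp`). [Baker–Gill–Solovay 1975, §1] [cite: BakerGillSolovay1975, §1] -/
def isPolyTime_ofFun : Prop :=
  ∀ {f : List Bool → β} {eb : Encoding β Bool} (hf : PolyTimeComputable (id : List Bool → List Bool) eb.encode f),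
    (ofFun f).IsPolyTime eb

end OracleAlg

/-! ### Relativised classes -/

/-- `PRel O = P^O`: languages decided by a polynomial-time oracle algorithm with oracle `O`
within a polynomial number of rounds and with polynomially long queries — some
`M : OracleAlg Bool` with `M.IsPolyTime encodingBoolBool` and a polynomial `q` such that, for
every `x`, `M.run O (q |x|) x = some [x ∈ L]` and every query asked has length `≤ q |x|`
(the query bound makes the transcript, hence the total running time, polynomial in `|x|` for
polynomially bounded oracles; module docstring). Noncomputable (`Set.boolIndicator`).
[Baker–Gill–Solovay 1975, §1; Arora–Barak 2009, Def. 3.4] [cite: BakerGillSolovay1975, §1] -/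
noncomputable def PRel (O : Oracle) : Set (Language Bool) :=
  {L | ∃ M : OracleAlg Bool, M.IsPolyTime encodingBoolBool ∧
    ∃ q : Polynomial ℕ, ∀ x : List Bool,
      M.run O (q.eval x.length) x = some (L.boolIndicator x) ∧
        ∀ y ∈ M.queries O (q.eval x.length) x, y.length ≤ q.eval x.length}

/-- `FPRel O = FP^O`: string functions computed by a polynomial-time oracle algorithm with
oracle `O` within polynomially many rounds and with polynomially long queries (outputs encoded
by the identity string encoding `encodingList Bool`). [Arora–Barak 2009, §17.2 (`FP^{#P}`);
Baker–Gill–Solovay 1975, §1] [cite: AroraBarak2009, §17.2 ( FP^{#P}] -/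
def FPRel (O : Oracle) : Set (List Bool → List Bool) :=
  {f | ∃ M : OracleAlg (List Bool), M.IsPolyTime (encodingList Bool) ∧
    ∃ q : Polynomial ℕ, ∀ x : List Bool,
      M.run O (q.eval x.length) x = some (f x) ∧
        ∀ y ∈ M.queries O (q.eval x.length) x, y.length ≤ q.eval x.length}

/-- `NPRel O = NP^O := polyExists (PRel O)`: polynomially bounded certificates verified in
`P^O` (equivalently, nondeterministic polynomial-time oracle machines).
[Baker–Gill–Solovay 1975, §1; Arora–Barak 2009, Def. 3.4 and §5.5] [cite: BakerGillSolovay1975, §1] -/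
noncomputable def NPRel (O : Oracle) : Set (Language Bool) :=
  polyExists (PRel O)

/-- `coNPRel O = coNP^O := co (NPRel O)`. [Baker–Gill–Solovay 1975, §1] [cite: BakerGillSolovay1975, §1] -/
noncomputable def coNPRel (O : Oracle) : Set (Language Bool) :=
  co (NPRel O)

/-- `BPPRel O = BPP^O := bp (PRel O)`: bounded-error probabilistic polynomial time relative to
`O`. [Arora–Barak 2009, Def. 7.3 with §3.4; Bennett–Gill, SIAM J. Comput. 10 (1981), §1] [cite: AroraBarak2009, Def. 7.3 with §3.4] -/
noncomputable def BPPRel (O : Oracle) : Set (Language Bool) :=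
  bp (PRel O)

/-- `PolyTimeTuringReducible L₁ L₂` (notation `L₁ ≤ᵀₚ L₂`, `open scoped Literature.CplxCore.Notation`):
polynomial-time Turing (Cook) reducibility, `L₁ ∈ P^{L₂}`. Resource-bounded analogue of
Mathlib's `TuringReducible` (`≤ᵀ`). [Cook 1971, §1 (P-reducibility); Ladner–Lynch–Selman 1975,
§2 (`≤ᵀᴾ`)] [cite: Cook1971, §1 (P-reducibility] -/
noncomputable def PolyTimeTuringReducible (L₁ L₂ : Language Bool) : Prop :=
  L₁ ∈ PRel (Oracle.ofLanguage L₂)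

/-- `L₁ ≤ᵀₚ L₂`: polynomial-time Turing reducibility `PolyTimeTuringReducible L₁ L₂`, scoped in
the notation namespace `Literature.CplxCore.Notation` (use `open scoped Literature.CplxCore.Notation`;
outline D7). [Cook 1971, §1] -/
scoped[Literature.Computability.Complexity.Notation] infix:50 " ≤ᵀₚ " => Literature.Computability.Complexity.PolyTimeTuringReducible

open scoped Notation

/-- `PRelClass C = P^C := ⋃ L ∈ C, P^L`: polynomial time relative to some language of the class
`C` (so `P^NP = PRelClass NP`, `Δ₂ᵖ = PRelClass NP`). [Arora–Barak 2009, §5.5 (`P^{NP}`,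
Def. 5.11 area); Baker–Gill–Solovay 1975, §1] [cite: AroraBarak2009, §5.5 ( P^{NP}   Def. 5.11 area] -/
noncomputable def PRelClass (C : Set (Language Bool)) : Set (Language Bool) :=
  ⋃ L ∈ C, PRel (Oracle.ofLanguage L)

/-- `NPRelClass C = NP^C := ⋃ L ∈ C, NP^L` (so `Σ₂ᵖ = NP^NP = NPRelClass NP`).
[Arora–Barak 2009, §5.5, Thm. 5.12; Baker–Gill–Solovay 1975, §1] [cite: AroraBarak2009, §5.5  Thm. 5.12] -/
noncomputable def NPRelClass (C : Set (Language Bool)) : Set (Language Bool) :=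
  ⋃ L ∈ C, NPRel (Oracle.ofLanguage L)

/-- `BPPRelClass C = BPP^C := ⋃ L ∈ C, BPP^L`. [Arora–Barak 2009, §7 with §3.4] [cite: AroraBarak2009, §7 with §3.4] -/
noncomputable def BPPRelClass (C : Set (Language Bool)) : Set (Language Bool) :=
  ⋃ L ∈ C, BPPRel (Oracle.ofLanguage L)

/-! ### API -/

/-- Unfolding lemma for `PRel`. [Arora–Barak 2009, Def. 3.4] [cite: AroraBarak2009, Def. 3.4] -/
theorem mem_PRel_iff {O : Oracle} {L : Language Bool} :
    L ∈ PRel O ↔ ∃ M : OracleAlg Bool, M.IsPolyTime encodingBoolBool ∧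
      ∃ q : Polynomial ℕ, ∀ x : List Bool,
        M.run O (q.eval x.length) x = some (L.boolIndicator x) ∧
          ∀ y ∈ M.queries O (q.eval x.length) x, y.length ≤ q.eval x.length :=
  Iff.rfl

/-- Unfolding lemma for `≤ᵀₚ`: `L₁ ≤ᵀₚ L₂ ↔ L₁ ∈ P^{L₂}`. [Cook 1971, §1] [cite: Cook1971, §1] -/
theorem polyTimeTuringReducible_iff {L₁ L₂ : Language Bool} :
    L₁ ≤ᵀₚ L₂ ↔ L₁ ∈ PRel (Oracle.ofLanguage L₂) :=
  Iff.rfl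

/-- Unfolding lemma for `PRelClass`: `L ∈ P^C ↔ ∃ A ∈ C, L ≤ᵀₚ A`. [Arora–Barak 2009, §5.5] [cite: AroraBarak2009, §5.5] -/
theorem mem_PRelClass_iff {C : Set (Language Bool)} {L : Language Bool} :
    L ∈ PRelClass C ↔ ∃ A ∈ C, L ≤ᵀₚ A := by
  simp only [PRelClass, Set.mem_iUnion, exists_prop]
  rfl

/-- `PRelClass` is monotone in the class of oracles. [Arora–Barak 2009, §5.5] [cite: AroraBarak2009, §5.5] -/
theorem PRelClass_mono {C D : Set (Language Bool)} (h : C ⊆ D) : PRelClass C ⊆ PRelClass D := by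
  intro L hL
  obtain ⟨A, hA, hLA⟩ := mem_PRelClass_iff.1 hL
  exact mem_PRelClass_iff.2 ⟨A, h hA, hLA⟩

/-- `P ⊆ P^O` for every oracle: a polynomial-time machine is a query-free oracle algorithm.
(Via `mem_P_iff` and `isPolyTime_ofFun`.) [Baker–Gill–Solovay 1975, §1] [cite: BakerGillSolovay1975, §1] -/
def P_subset_PRel : Prop :=
  ∀ (O : Oracle),
    Classes.P ⊆ PRel O

/- interim proof relied on results that are now named facts (D-0014); demoted to a fact by the M5 import, proof preserved:
:= by
  intro L hL
  refine ⟨OracleAlg.ofFun L.boolIndicator,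
    OracleAlg.isPolyTime_ofFun (polyTimeDecidable_iff.1 (mem_P_iff.1 hL)), 1, fun x => ⟨?_, ?_⟩⟩
  · rw [Polynomial.eval_one]
    rfl
  · simp
-/

/-- `P^∅ = P`: the empty oracle gives no power (its constant answers can be hard-wired, and
the polynomially many polynomial-time rounds compose to a polynomial-time machine).
[Baker–Gill–Solovay 1975, §1] [cite: BakerGillSolovay1975, §1] -/
def PRel_empty : Prop :=
  PRel Oracle.empty = Classes.P

/-- `A ∈ P^A`: query the input itself and output the answer bit.
[Baker–Gill–Solovay 1975, §1; Ladner–Lynch–Selman 1975, §2 (reflexivity of `≤ᵀᴾ`)] [cite: BakerGillSolovay1975, §1] -/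
def self_mem_PRel_ofLanguage : Prop :=
  ∀ (A : Language Bool),
    A ∈ PRel (Oracle.ofLanguage A)

/-- Polynomial-time Turing reducibility is reflexive. [Ladner–Lynch–Selman 1975, §2] [cite: LadnerLynchSelman1975, §2] -/
def polyTimeTuringReducible_refl : Prop :=
  ∀ (L : Language Bool),
    L ≤ᵀₚ L

/- interim proof relied on results that are now named facts (D-0014); demoted to a fact by the M5 import, proof preserved:
:=
  self_mem_PRel_ofLanguage L
-/

/-- Karp reducibility implies Cook reducibility: `L₁ ≤ₚ L₂ → L₁ ≤ᵀₚ L₂` (compute `f x`, ask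
the single query `f x`, output the answer). [Ladner–Lynch–Selman 1975, §2 (`≤ₘᴾ ⇒ ≤ᵀᴾ`);
Arora–Barak 2009, §3.4] [cite: LadnerLynchSelman1975, §2 ( ≤ₘᴾ ⇒ ≤ᵀᴾ] -/
def PolyTimeKarpReducible.turing : Prop :=
  ∀ {L₁ L₂ : Language Bool} (h : L₁ ≤ₚ L₂),
    L₁ ≤ᵀₚ L₂

/-- Polynomial-time Turing reducibility is transitive: `L₁ ≤ᵀₚ L₂ → L₂ ≤ᵀₚ L₃ → L₁ ≤ᵀₚ L₃`
(answer each query of the first machine by running the second; polynomials compose).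
[Ladner–Lynch–Selman 1975, §2; Cook 1971, §1] [cite: LadnerLynchSelman1975, §2] -/
def polyTimeTuringReducible_trans : Prop :=
  ∀ {L₁ L₂ L₃ : Language Bool} (h₁₂ : L₁ ≤ᵀₚ L₂) (h₂₃ : L₂ ≤ᵀₚ L₃),
    L₁ ≤ᵀₚ L₃

/-- `P^O` is closed downwards under Cook reductions (`P^{P^O} = P^O`):
`L ≤ᵀₚ A → A ∈ PRel O → L ∈ PRel O`.
[Ladner–Lynch–Selman 1975, §2; Baker–Gill–Solovay 1975, §1] [cite: LadnerLynchSelman1975, §2] -/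
def mem_PRel_of_polyTimeTuringReducible : Prop :=
  ∀ {O : Oracle} {L A : Language Bool} (h : L ≤ᵀₚ A) (hA : A ∈ PRel O),
    L ∈ PRel O

/-- `P^O ⊆ NP^O` (empty certificate). [Baker–Gill–Solovay 1975, §1] [cite: BakerGillSolovay1975, §1] -/
def PRel_subset_NPRel : Prop :=
  ∀ (O : Oracle),
    PRel O ⊆ NPRel O

/-- `P^O ⊆ BPP^O` (ignore the coins). [Bennett–Gill 1981, §1] [cite: BennettGill1981, §1] -/
def PRel_subset_BPPRel : Prop :=
  ∀ (O : Oracle),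
    PRel O ⊆ BPPRel O

/-- `NPRel` unfolds to `polyExists (PRel O)` (definitional). [Arora–Barak 2009, §5.5] [cite: AroraBarak2009, §5.5] -/
theorem NPRel_eq (O : Oracle) : NPRel O = polyExists (PRel O) :=
  rfl

/-- `P ⊆ P^C` for every nonempty class `C`. [Baker–Gill–Solovay 1975, §1] [cite: BakerGillSolovay1975, §1] -/
def P_subset_PRelClass : Prop :=
  ∀ {C : Set (Language Bool)} (hC : C.Nonempty),
    Classes.P ⊆ PRelClass C

/- interim proof relied on results that are now named facts (D-0014); demoted to a fact by the M5 import, proof preserved: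
:= by
  obtain ⟨A, hA⟩ := hC
  intro L hL
  exact mem_PRelClass_iff.2 ⟨A, hA, P_subset_PRel _ hL⟩
-/

/-- `C ⊆ P^C`: every language of `C` is in `P` relative to itself.
[Baker–Gill–Solovay 1975, §1] [cite: BakerGillSolovay1975, §1] -/
def self_subset_PRelClass : Prop :=
  ∀ (C : Set (Language Bool)),
    C ⊆ PRelClass C

/- interim proof relied on results that are now named facts (D-0014); demoted to a fact by the M5 import, proof preserved:
:=
  fun A hA => mem_PRelClass_iff.2 ⟨A, hA, polyTimeTuringReducible_refl A⟩
-/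

end Literature.Computability.Complexity
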